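import Summits.BirchSwinnertonDyer.Rank1Residual.ManinAdditive.ALTateCohomology
import Literature.NumberTheory.QuadraticFields.BinaryQuadraticFormsClassNumber
import HarnessLib

/-!
# desc's `reducedFormCount` IS the tree's form class number `BinQF.classNumber` (cell `bsd-f2-manin`, typer g16)

`ALTateCohomology.reducedFormCount D` (desc g12, the helper behind `alFixedPointCount` = `ν_Q(N)` and the
class-number clauses of E-desc-71…77b / 86–90) counts coefficient pairs `(a, b)` of primitive reduced positive
definite forms of discriminant `D` by a `Finset.filter`; the tree's
`Literature.NumberTheory.QuadraticFields.Quadratic.BinQF.classNumber D` (Cox, Thm. 2.13) counts the reduced forms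
themselves (`reducedFormsList`, complete and duplicate-free: `mem_reducedFormsList_iff`, `nodup_reducedFormsList`).
THIS FILE PROVES they agree for EVERY `D : ℤ` (`reducedFormCount_eq_classNumber`): for `D < 0`, `D ≡ 0, 1 (4)` by
the bijection `(a, b) ↦ (a, b, (b² − D)/4a)`; otherwise both sides are `0` (a reduced positive definite form has
`D = b² − 4ac ≤ −3a² < 0` and `D ≡ b² (mod 4)`).  Hence desc's fixed-point counts and the typer's Gauss fact
`Gauss_threeSquaresPrim_classNumber` (`GaussThreeSquaresClassNumber.lean`, over `BinQF.classNumber`) speak the same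
currency; REF1 §R94 (A2) had checked `reducedFormCount = h(D)` numerically at 410/410 discriminants — now a theorem.
Theorem-only; nothing asserted; BSD is not proved by this.
-/

namespace Summit.BirchSwinnertonDyer.Rank1Residual.ManinAdditive.ALTateCohomology

open Literature.NumberTheory.QuadraticFields.Quadratic

/-- A reduced primitive positive definite form has negative discriminant `≡ 0, 1 (mod 4)` and `a ≤ −D`,
`|b| ≤ −D`. [cite: Cox2013, §2.A eq. (2.4) and (2.8)] -/
theorem BinQF.neg_disc_bounds {D : ℤ} {f : BinQF} (hf : f.IsPosPrim D) (hr : f.IsReduced) :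
    D < 0 ∧ (D % 4 = 0 ∨ D % 4 = 1) ∧ f.a ≤ -D ∧ |f.b| ≤ -D := by
  obtain ⟨hdisc, ha, -⟩ := hf
  obtain ⟨h1, h2, -⟩ := hr
  simp only [BinQF.disc] at hdisc
  have hb2 : f.b ^ 2 ≤ f.a ^ 2 := by nlinarith [abs_nonneg f.b, abs_mul_abs_self f.b]
  have hD : 3 * (f.a * f.a) ≤ -D := by nlinarith
  have haD : f.a ≤ -D := by nlinarith
  refine ⟨by nlinarith, ?_, haD, le_trans h1 haD⟩
  rcases Int.even_or_odd' f.b with ⟨k, hk | hk⟩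
  · have e : D = 4 * (k * k - f.a * f.c) := by rw [← hdisc, hk]; ring
    generalize k * k - f.a * f.c = m at e
    omega
  · have e : D = 4 * (k * k + k - f.a * f.c) + 1 := by rw [← hdisc, hk]; ring
    generalize k * k + k - f.a * f.c = m at e
    omega

/-- **`reducedFormCount D = BinQF.classNumber D` for every `D`.** [cite: Cox2013, Thm. 2.13 and Thm. 2.8] -/
theorem reducedFormCount_eq_classNumber (D : ℤ) : reducedFormCount D = BinQF.classNumber D := by
  rw [BinQF.classNumber_eq_card]
  unfold reducedFormCount
  split_ifs with h
  · obtain ⟨hD, hD4⟩ := h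
    refine Finset.card_nbij' (fun ab : ℤ × ℤ => (⟨ab.1, ab.2, (ab.2 * ab.2 - D) / (4 * ab.1)⟩ : BinQF))
      (fun f => (f.a, f.b)) ?_ ?_ (fun ab _ => rfl) ?_
    · -- the pair `(a, b)` gives a reduced primitive positive definite form
      rintro ⟨a, b⟩ hab
      rw [Finset.mem_coe, Finset.mem_filter, Finset.mem_product, Finset.mem_Icc, Finset.mem_Icc] at hab
      obtain ⟨⟨⟨ha1, -⟩, -⟩, hmod, hlt, hle, hac, hsgn, hg⟩ := hab
      simp only at hmod hlt hle hac hsgn hg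
      have hmul : 4 * a * ((b * b - D) / (4 * a)) = b * b - D :=
        Int.mul_ediv_cancel' (Int.dvd_of_emod_eq_zero hmod)
      rw [Finset.mem_coe, List.mem_toFinset, BinQF.mem_reducedFormsList_iff _ hD]
      refine ⟨⟨?_, by simp only; omega, ?_⟩, ?_, hac, ?_⟩
      · simp only [BinQF.disc]; nlinarith [hmul]
      · simp only [BinQF.IsPrimitive]
        simpa [Int.gcd_eq_natAbs, Int.natAbs_natCast] using hg
      · simp only; exact abs_le.mpr ⟨by omega, hle⟩
      · simp only
        rintro (h1 | h2)
        · rcases abs_cases b with ⟨hb', -⟩ | ⟨hb', -⟩ <;> omega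
        · rcases hsgn with h0 | hne
          · exact h0
          · exact absurd h2 hne
    · -- a reduced form gives an admissible pair
      intro f hf
      rw [Finset.mem_coe, List.mem_toFinset, BinQF.mem_reducedFormsList_iff _ hD] at hf
      obtain ⟨hpp, hr⟩ := hf
      obtain ⟨-, -, haD, hbD⟩ := BinQF.neg_disc_bounds hpp hr
      obtain ⟨hdisc, ha, hprim⟩ := hpp
      obtain ⟨h1, h2, h3⟩ := hr
      simp only [BinQF.disc] at hdisc
      have hmul : f.b * f.b - D = 4 * f.a * f.c := by rw [← hdisc]; ring
      have h4a : 4 * f.a ≠ 0 := by omega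
      have hcdef : (f.b * f.b - D) / (4 * f.a) = f.c := by
        rw [hmul]; exact Int.mul_ediv_cancel_left _ h4a
      rw [Finset.mem_coe, Finset.mem_filter, Finset.mem_product, Finset.mem_Icc, Finset.mem_Icc]
      simp only [hcdef]
      have hb := abs_le.mp h1
      have hbD' := abs_le.mp hbD
      refine ⟨⟨⟨by omega, haD⟩, by omega, by omega⟩, ?_, ?_, hb.2, h2, ?_, ?_⟩
      · rw [hmul]; exact Int.mul_emod_right _ _
      · rcases eq_or_lt_of_le hb.1 with he | hlt
        · have : |f.b| = f.a := by rw [← he, abs_neg, abs_of_pos ha]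
          have := h3 (Or.inl this); omega
        · exact hlt
      · by_cases hac : f.a = f.c
        · exact Or.inl (h3 (Or.inr hac))
        · exact Or.inr hac
      · simp only [BinQF.IsPrimitive] at hprim
        simpa [Int.gcd_eq_natAbs, Int.natAbs_natCast] using hprim
    · -- right inverse: the third coefficient is recovered
      intro f hf
      rw [Finset.mem_coe, List.mem_toFinset, BinQF.mem_reducedFormsList_iff _ hD] at hf
      obtain ⟨⟨hdisc, ha, -⟩, -⟩ := hf
      simp only [BinQF.disc] at hdisc
      have hmul : f.b * f.b - D = 4 * f.a * f.c := by rw [← hdisc]; ring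
      have h4a : 4 * f.a ≠ 0 := by omega
      ext
      · rfl
      · rfl
      · show (f.b * f.b - D) / (4 * f.a) = f.c
        rw [hmul]; exact Int.mul_ediv_cancel_left _ h4a
  · -- no reduced primitive positive definite form of discriminant `D`: both sides vanish
    symm
    rw [Finset.card_eq_zero, Finset.eq_empty_iff_forall_notMem]
    intro f hf
    rw [List.mem_toFinset] at hf
    have hf' : f ∈ BinQF.candidatesList D ∧ f.IsPosPrim D ∧ f.IsReduced := by
      simpa [BinQF.reducedFormsList, List.mem_filter] using hf
    obtain ⟨hD, hD4, -⟩ := BinQF.neg_disc_bounds hf'.2.1 hf'.2.2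
    exact h ⟨hD, hD4⟩

/-- Hence desc's fixed-point count `alFixedPointCount N Q` (= `ν_Q(N)`) is a class-number expression over the
tree's `BinQF.classNumber`. [cite: Ogg1974, p. 454 (the fixed points of `w_Q`)] -/
theorem alFixedPointCount_eq_classNumber (N Q : ℕ) :
    alFixedPointCount N Q =
      (BinQF.classNumber (-4 * (Q : ℤ)) : ℤ) *
          (∏ ℓ ∈ (N / Q).primeFactors, (1 + jacobiSym (-4 * (Q : ℤ)) ℓ)) +
        (if Q % 4 = 3 then
          (BinQF.classNumber (-(Q : ℤ)) : ℤ) * (∏ ℓ ∈ (N / Q).primeFactors, (1 + jacobiSym (-(Q : ℤ)) ℓ))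
        else 0) := by
  simp only [alFixedPointCount, reducedFormCount_eq_classNumber]

end Summit.BirchSwinnertonDyer.Rank1Residual.ManinAdditive.ALTateCohomology
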